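import Literature.ModelTheory.Quasiminimal.CountableModels
import HarnessLib

/-!
# Extending compatible face maps across a crown, without excellence (Haykazyan's tails)

Let `M` be a countable weakly quasiminimal pregeometry structure, `p : ℕ → M` and
`x : Fin l → M` jointly independent ("tail" generators and the vertices of a simplex), and write
`G_m = cl {p_j : j ≥ m}` for the tails and `F_i^{(m)} = cl (G_m ∪ {x_t : t ≠ i})` for the faces of
the simplex `D^{(m)} = cl (G_m ∪ {x_t})`. Suppose closed partial embeddings `g_i` are prescribed on
the faces `F_i^{(n)}`, fixing the tail `G_n` pointwise, sending `x_t ↦ x'_t` (`t ≠ i`) for a second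
vertex tuple `x'` (with `p, x'` jointly independent), with the right images, and agreeing on the
pairwise intersections `cl (G_n ∪ {x_t : t ≠ i, i'})`. Then, after shrinking the tail to some `G_m`,
`m ≥ n`, there is ONE partial embedding `E` of the simplex `D^{(m)}` onto `cl (G_m ∪ {x'_t})`
extending every `g_i` on `F_i^{(m)}` (`exists_faceMaps_extension`).

This is the combinatorial heart of the categoricity proofs for quasiminimal classes —
J. Kirby, *On quasiminimal excellent classes*, JSL 75 (2010), proof of Thm 3.3 (the maps `h_k`
and the "composite embedding `τ = σ'⁻¹ f_{Y_k} σ`"), in the form given by L. Haykazyan,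
*Categoricity in quasiminimal pregeometry classes*, JSL 81 (2016), proof of Thm 16, Claim
(`τ = e θ⁻¹ e⁻¹ g_{Y_k} θ` with the *shrinking tails* `G_m = cl {b_j : j ≥ m}` supplying the
spare basis vector `b_m` swapped with `x_k` by `θ`). We run Haykazyan's induction on the number
`k` of faces incorporated, with the observation that his composite `τ_k` is itself defined on the
whole next simplex `cl (G_{m+1} ∪ X)` and agrees with the prescribed maps on the faces, so that
it can serve both as the auxiliary extension `e` of the next step and as the final extension:
no appeal to excellence (Kirby's axiom III / BHHKK 2014 Prop. 6.2) or to `σ`-saturation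
(Haykazyan Prop. 12) is needed — only Kirby 2010, Thm 2.1 (`CountableModels.lean`).

## Contents

* `FacePrescription L cl p x x' n jf g` — the hypotheses on the prescribed face maps `g i`, `i < jf`.
* `IsWeaklyQuasiminimalPregeometryStructure.exists_faceMaps_extension` — the extension theorem.

## References

* L. Haykazyan, *Categoricity in quasiminimal pregeometry classes*, J. Symbolic Logic 81 (2016)
  56–64, arXiv:1308.1892: Thm 16 and its Claim.
* J. Kirby, *On quasiminimal excellent classes*, J. Symbolic Logic 75 (2010) 551–564: Thm 2.1,
  proof of Thm 3.3.
-/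

noncomputable section

open Set FirstOrder FirstOrder.Language

universe u v w

namespace Literature.ModelTheory.Quasiminimal

variable {L : Language.{u, v}} {M : Type w} [L.Structure M] {cl : Set M → Set M}

/-! ### Joint independence of tails and vertices -/

section Indep

variable {p : ℕ → M} {l : ℕ} {x : Fin l → M}

/-- A member of a jointly independent family `(p, x)` is not in the closure of the others:
`p m ∉ cl (p[P] ∪ x[S])` for `m ∉ P`. [folklore] -/
theorem notMem_cl_inl (h : IsPregeometry cl) (hpx : IndepFamilyOver cl ∅ (Sum.elim p x))
    {m : ℕ} {P : Set ℕ} (hm : m ∉ P) (S : Set (Fin l)) : p m ∉ cl (p '' P ∪ x '' S) := by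
  intro hmem
  have := hpx (Sum.inl m)
  rw [empty_union] at this
  refine this (h.mono ?_ hmem)
  rintro _ (⟨j, hj, rfl⟩ | ⟨t, -, rfl⟩)
  · exact ⟨Sum.inl j, fun hji => hm (by cases hji; exact hj), rfl⟩
  · exact ⟨Sum.inr t, (fun h => by cases h), rfl⟩

/-- `x k ∉ cl (p[P] ∪ x[S])` for `k ∉ S`. [folklore] -/
theorem notMem_cl_inr (h : IsPregeometry cl) (hpx : IndepFamilyOver cl ∅ (Sum.elim p x))
    (P : Set ℕ) {k : Fin l} {S : Set (Fin l)} (hk : k ∉ S) : x k ∉ cl (p '' P ∪ x '' S) := by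
  intro hmem
  have := hpx (Sum.inr k)
  rw [empty_union] at this
  refine this (h.mono ?_ hmem)
  rintro _ (⟨j, -, rfl⟩ | ⟨t, ht, rfl⟩)
  · exact ⟨Sum.inl j, (fun h => by cases h), rfl⟩
  · exact ⟨Sum.inr t, fun htk => hk (by cases htk; exact ht), rfl⟩

/-- A two-element family `(a, b)` is independent over `G` when `a ∉ cl (G ∪ {b})` and
`b ∉ cl (G ∪ {a})`. [folklore] -/
theorem indepFamilyOver_bool {G : Set M} {a b : M} (ha : a ∉ cl (G ∪ {b}))
    (hb : b ∉ cl (G ∪ {a})) : IndepFamilyOver cl G (fun t : Bool => if t then a else b) := by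
  intro t
  cases t
  · have : (fun t : Bool => if t then a else b) '' {s | s ≠ false} = {a} := by
      ext y; simp only [mem_image, mem_setOf_eq, mem_singleton_iff]
      constructor
      · rintro ⟨s, hs, rfl⟩; cases s <;> simp_all
      · rintro rfl; exact ⟨true, by simp, by simp⟩
    simpa [this] using hb
  · have : (fun t : Bool => if t then a else b) '' {s | s ≠ true} = {b} := by
      ext y; simp only [mem_image, mem_setOf_eq, mem_singleton_iff]
      constructor
      · rintro ⟨s, hs, rfl⟩; cases s <;> simp_all
      · rintro rfl; exact ⟨false, by simp, by simp⟩
    simpa [this] using ha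

omit [L.Structure M] in
/-- The range of the two-element family. [folklore] -/
theorem range_bool (a b : M) : range (fun t : Bool => if t then a else b) = {a, b} := by
  ext y
  simp only [mem_range, Bool.exists_bool, mem_insert_iff, mem_singleton_iff]
  constructor
  · rintro (h | h) <;> simp at h <;> tauto
  · rintro (rfl | rfl)
    · exact Or.inr (by simp)
    · exact Or.inl (by simp)

/-- A one-element family is independent over `G` when its value is outside `cl G`. [folklore] -/
theorem indepFamilyOver_unit {G : Set M} {a : M} (ha : a ∉ cl G) :
    IndepFamilyOver cl G (fun _ : Unit => a) := by
  intro t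
  have : (fun _ : Unit => a) '' {s | s ≠ t} = ∅ := by
    ext y; simp only [mem_image, mem_setOf_eq, mem_empty_iff_false, iff_false]
    rintro ⟨s, hs, -⟩; exact hs (Subsingleton.elim s t)
  rw [this, union_empty]
  exact ha

end Indep

/-! ### Prescribed face maps -/

section Prescription

variable (L cl)

/-- **Prescribed face maps** (the data `g_{Y_i}` of Kirby 2010, proof of Thm 3.3 / Haykazyan
2016, proof of Thm 16, with Haykazyan's tails): for the tail generators `p`, vertices `x`,
target vertices `x'`, tail level `n` and number `jf` of prescribed faces, each `g i`, `i < jf`,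
is a partial embedding of the face `F_i = cl (p[≥ n] ∪ {x_t : t ≠ i})` onto
`cl (p[≥ n] ∪ {x'_t : t ≠ i})`, fixing the tail `cl (p[≥ n])` pointwise, sending `x_t ↦ x'_t`,
and the prescribed `g i` agree on the pairwise intersections of their faces (only the faces
`i < jf` are constrained; `g i` for `i ≥ jf` is ignored).
[cite: Kirby2010QMEC, Thm 3.3 (proof)] [cite: Haykazyan2016, Thm 16 (proof)] -/
structure FacePrescription (p : ℕ → M) {l : ℕ} (x x' : Fin l → M) (n jf : ℕ)
    (g : Fin l → M → M) : Prop where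
  /-- `g i` is a partial embedding on the face `F_i^{(n)}` (for the prescribed faces `i < jf`). -/
  isQFEmbOn : ∀ i : Fin l, (i : ℕ) < jf → IsQFEmbOn L (g i) (cl (p '' {j | n ≤ j} ∪ x '' {t | t ≠ i}))
  /-- … with image the corresponding face for `x'`. -/
  image_eq : ∀ i : Fin l, (i : ℕ) < jf → g i '' cl (p '' {j | n ≤ j} ∪ x '' {t | t ≠ i}) =
    cl (p '' {j | n ≤ j} ∪ x' '' {t | t ≠ i})
  /-- `g i` fixes the tail pointwise. -/
  fix_tail : ∀ i : Fin l, (i : ℕ) < jf → ∀ z ∈ cl (p '' {j | n ≤ j}), g i z = z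
  /-- `g i` sends the vertices `x_t`, `t ≠ i`, to `x'_t`. -/
  apply_vertex : ∀ i : Fin l, (i : ℕ) < jf → ∀ t, t ≠ i → g i (x t) = x' t
  /-- The `g i` agree on the pairwise intersections of the prescribed faces. -/
  compat : ∀ i i' : Fin l, (i : ℕ) < jf → (i' : ℕ) < jf →
    ∀ z ∈ cl (p '' {j | n ≤ j} ∪ x '' {t | t ≠ i ∧ t ≠ i'}), g i z = g i' z

end Prescription

/-! ### The extension theorem -/

namespace IsWeaklyQuasiminimalPregeometryStructure

/-- **Extending compatible face maps across the crown** (Kirby 2010, proof of Thm 3.3;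
Haykazyan 2016, proof of Thm 16, Claim — with Haykazyan's shrinking tails, and without
excellence). Let `M` be a countable weakly quasiminimal pregeometry structure, `(p, x)` and
`(p, x')` jointly independent, and `g` prescribed face maps at tail level `n` on the faces
`i < jf` (`0 < jf ≤ l`). Then for some `m ≥ n` there is a partial embedding `E` of the simplex
`cl (p[≥ m] ∪ {x_t})` onto `cl (p[≥ m] ∪ {x'_t})` which agrees with `g i` on the face
`cl (p[≥ m] ∪ {x_t : t ≠ i})` for every `i < jf`, fixes the tail `cl (p[≥ m])` pointwise and sends
`x_t ↦ x'_t`. Proof: `E_0` extends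
`g_0 ∪ {x_0 ↦ x'_0}` by Thm 2.1; `E_{k+1} = E_k θ⁻¹ E_k⁻¹ g_{k+1} θ` on `cl (p[≥ m+1] ∪ X)` where
`θ` is the automorphism of `cl (p[≥ m] ∪ X)` over `cl (p[≥ m+1] ∪ X ∖ {x_{k+1}})` swapping `x_{k+1}`
and `p_m` (Thm 2.1). [cite: Kirby2010QMEC, Thm 3.3 (proof)] [cite: Haykazyan2016, Thm 16 (proof, Claim)] -/
theorem exists_faceMaps_extension [Countable M]
    (hW : IsWeaklyQuasiminimalPregeometryStructure L M cl) {p : ℕ → M} {l : ℕ}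
    {x x' : Fin l → M} {n jf : ℕ} {g : Fin l → M → M}
    (hpx : IndepFamilyOver cl ∅ (Sum.elim p x)) (hpx' : IndepFamilyOver cl ∅ (Sum.elim p x'))
    (hg : FacePrescription L cl p x x' n jf g) (hjf : 0 < jf) (hjfl : jf ≤ l) :
    ∃ m, n ≤ m ∧ ∃ E : M → M, IsQFEmbOn L E (cl (p '' {j | m ≤ j} ∪ range x)) ∧
      (∀ i : Fin l, (i : ℕ) < jf → ∀ z ∈ cl (p '' {j | m ≤ j} ∪ x '' {t | t ≠ i}), E z = g i z) ∧
      (∀ z ∈ cl (p '' {j | m ≤ j}), E z = z) ∧ (∀ t, E (x t) = x' t) ∧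
      E '' cl (p '' {j | m ≤ j} ∪ range x) = cl (p '' {j | m ≤ j} ∪ range x') := by
  classical
  have hP := hW.isPregeometry
  have hl : 0 < l := lt_of_lt_of_le hjf hjfl
  haveI : Nonempty M := ⟨p 0⟩
  -- notation
  set T : ℕ → Set M := fun m => cl (p '' {j | m ≤ j}) with hT
  set cs : ℕ → Set (Fin l) → Set M := fun m S => cl (p '' {j | m ≤ j} ∪ x '' S) with hcs
  set cs' : ℕ → Set (Fin l) → Set M := fun m S => cl (p '' {j | m ≤ j} ∪ x' '' S) with hcs'
  have hcs_cl : ∀ m S, cl (cs m S) = cs m S := fun m S => hP.cl_cl _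
  have hcs'_cl : ∀ m S, cl (cs' m S) = cs' m S := fun m S => hP.cl_cl _
  have hT_cl : ∀ m, cl (T m) = T m := fun m => hP.cl_cl _
  have hcs_mono : ∀ {m m' : ℕ} {S S' : Set (Fin l)}, m ≤ m' → S' ⊆ S → cs m' S' ⊆ cs m S :=
    fun hmm' hSS' => hP.mono (union_subset_union
      (image_mono fun j (hj : _ ≤ j) => hmm'.trans hj) (image_mono hSS'))
  have hcs'_mono : ∀ {m m' : ℕ} {S S' : Set (Fin l)}, m ≤ m' → S' ⊆ S → cs' m' S' ⊆ cs' m S :=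
    fun hmm' hSS' => hP.mono (union_subset_union
      (image_mono fun j (hj : _ ≤ j) => hmm'.trans hj) (image_mono hSS'))
  have hT_cs : ∀ m S, T m ⊆ cs m S := fun m S => hP.mono subset_union_left
  have hT_cs' : ∀ m S, T m ⊆ cs' m S := fun m S => hP.mono subset_union_left
  have hp_cs : ∀ {m j} (S), m ≤ j → p j ∈ cs m S := fun S hmj => hP.subset_cl _ (Or.inl ⟨_, hmj, rfl⟩)
  have hx_cs : ∀ (m) {t S}, t ∈ S → x t ∈ cs m S := fun m t S ht => hP.subset_cl _ (Or.inr ⟨t, ht, rfl⟩)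
  have hx'_cs' : ∀ (m) {t S}, t ∈ S → x' t ∈ cs' m S :=
    fun m t S ht => hP.subset_cl _ (Or.inr ⟨t, ht, rfl⟩)
  have hrange : ∀ m, cl (p '' {j | m ≤ j} ∪ range x) = cs m univ := fun m => by
    simp only [hcs, image_univ]
  have hrange' : ∀ m, cl (p '' {j | m ≤ j} ∪ range x') = cs' m univ := fun m => by
    simp only [hcs', image_univ]
  -- adding the next tail generator
  have hgen_succ : ∀ m (S : Set (Fin l)), p '' {j | m + 1 ≤ j} ∪ x '' S ∪ {p m} =
      p '' {j | m ≤ j} ∪ x '' S := by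
    intro m S
    ext y
    simp only [mem_union, mem_image, mem_setOf_eq, mem_singleton_iff]
    constructor
    · rintro ((⟨j, hj, rfl⟩ | h) | rfl)
      · exact Or.inl ⟨j, by omega, rfl⟩
      · exact Or.inr h
      · exact Or.inl ⟨m, le_rfl, rfl⟩
    · rintro (⟨j, hj, rfl⟩ | h)
      · by_cases hjm : j = m
        · subst hjm; exact Or.inr rfl
        · exact Or.inl (Or.inl ⟨j, by omega, rfl⟩)
      · exact Or.inl (Or.inr h)
  have hgen_succ' : ∀ m (S : Set (Fin l)), p '' {j | m + 1 ≤ j} ∪ x' '' S ∪ {p m} =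
      p '' {j | m ≤ j} ∪ x' '' S := by
    intro m S
    ext y
    simp only [mem_union, mem_image, mem_setOf_eq, mem_singleton_iff]
    constructor
    · rintro ((⟨j, hj, rfl⟩ | h) | rfl)
      · exact Or.inl ⟨j, by omega, rfl⟩
      · exact Or.inr h
      · exact Or.inl ⟨m, le_rfl, rfl⟩
    · rintro (⟨j, hj, rfl⟩ | h)
      · by_cases hjm : j = m
        · subst hjm; exact Or.inr rfl
        · exact Or.inl (Or.inl ⟨j, by omega, rfl⟩)
      · exact Or.inl (Or.inr h)
  -- images of closures under maps fixing the tail and relabelling vertices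
  have himage : ∀ {φ : M → M} {A : Set M} (_ : IsQFEmbOn L φ A) {m : ℕ} {S : Set (Fin l)}
      {y : Fin l → M}, cs m S ⊆ A → (∀ j, m ≤ j → φ (p j) = p j) → (∀ t ∈ S, φ (x t) = y t) →
      cl (p '' {j | m ≤ j} ∪ y '' S) ⊆ φ '' A →
      φ '' cs m S = cl (p '' {j | m ≤ j} ∪ y '' S) := by
    intro φ A hφ m S y hA hp hxv him
    have hgen : φ '' (p '' {j | m ≤ j} ∪ x '' S) = p '' {j | m ≤ j} ∪ y '' S := by
      rw [image_union, ← image_comp, ← image_comp]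
      congr 1
      · exact image_congr fun j hj => hp j hj
      · exact image_congr fun t ht => hxv t ht
    rw [← hgen]
    refine hφ.image_cl_eq hW hA ?_
    rw [hgen]; exact him
  -- the inductive statement
  have main : ∀ k : ℕ, k < jf → ∃ E : M → M, IsQFEmbOn L E (cs (n + k) univ) ∧
      (∀ i : Fin l, (i : ℕ) ≤ k → ∀ z ∈ cs (n + k) {t | t ≠ i}, E z = g i z) ∧
      (∀ t, E (x t) = x' t) ∧ E '' cs (n + k) univ = cs' (n + k) univ := by
    intro k
    induction k with
    | zero =>
      intro _
      -- `E₀` extends `g 0 ∪ {x 0 ↦ x' 0}` (Thm 2.1)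
      set i₀ : Fin l := ⟨0, hl⟩ with hi₀
      have hi₀j : (i₀ : ℕ) < jf := hjf
      set G := cs n {t | t ≠ i₀} with hG
      have hGcl : cl G = G := hcs_cl _ _
      have hGim : g i₀ '' G = cs' n {t | t ≠ i₀} := hg.image_eq i₀ hi₀j
      have hx0 : x i₀ ∉ cl G := by
        rw [hGcl]; exact notMem_cl_inr hP hpx _ (fun h => h rfl)
      have hx0' : x' i₀ ∉ cl (g i₀ '' G) := by
        rw [hGim, hcs'_cl]; exact notMem_cl_inr hP hpx' _ (fun h => h rfl)
      obtain ⟨E, hE, hEg, hEx, hEim⟩ := hW.exists_isQFEmbOn_extend_indepFamily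
        (Or.inl ⟨hGcl, by rw [hGim]; exact hcs'_cl _ _⟩) (hg.isQFEmbOn i₀ hi₀j)
        (indepFamilyOver_unit hx0) (indepFamilyOver_unit hx0')
      have hdom : cl (G ∪ range fun _ : Unit => x i₀) = cs n univ := by
        rw [range_const, hG, hP.cl_cl_union, union_assoc, ← image_singleton (f := x), ← image_union]
        simp only [hcs, image_univ]
        congr 2
        have : {t : Fin l | t ≠ i₀} ∪ {i₀} = univ := by
          ext t; by_cases h : t = i₀ <;> simp [h]
        rw [this, image_univ]
      have him : cl (g i₀ '' G ∪ range fun _ : Unit => x' i₀) = cs' n univ := by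
        rw [range_const, hGim, hP.cl_cl_union, union_assoc, ← image_singleton (f := x'),
          ← image_union]
        simp only [hcs', image_univ]
        congr 2
        have : {t : Fin l | t ≠ i₀} ∪ {i₀} = univ := by
          ext t; by_cases h : t = i₀ <;> simp [h]
        rw [this, image_univ]
      rw [hdom] at hE
      rw [hdom, him] at hEim
      simp only [Nat.add_zero]
      refine ⟨E, hE, fun i hi z hz => ?_, fun t => ?_, hEim⟩
      · have : i = i₀ := Fin.ext (by simpa [hi₀] using hi)
        subst this
        exact hEg hz
      · by_cases ht : t = i₀
        · subst ht; exact hEx ()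
        · rw [hEg (hx_cs n ht), hg.apply_vertex i₀ hi₀j t ht]
    | succ k ih =>
      intro hk1
      obtain ⟨E, hE, hEg, hEx, hEim⟩ := ih (Nat.lt_of_succ_lt hk1)
      set m := n + k with hm
      have hnm : n ≤ m := Nat.le_add_right n k
      have hk1l : k + 1 < l := lt_of_lt_of_le hk1 hjfl
      set κ : Fin l := ⟨k + 1, hk1l⟩ with hκ
      have hκj : (κ : ℕ) < jf := hk1
      have h0j : ((⟨0, hl⟩ : Fin l) : ℕ) < jf := hjf
      -- facts about `E` at level `m`
      have hEfix : ∀ z ∈ T m, E z = z := fun z hz => by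
        rw [hEg ⟨0, hl⟩ (Nat.zero_le k) z (hT_cs m _ hz)]
        exact hg.fix_tail _ h0j z (hP.mono (image_mono fun j (hj : m ≤ j) => hnm.trans hj) hz)
      have hEp : ∀ j, m ≤ j → E (p j) = p j := fun j hj => hEfix _ (hP.subset_cl _ ⟨j, hj, rfl⟩)
      have hEim' : ∀ (m') (S : Set (Fin l)), m ≤ m' → E '' cs m' S = cs' m' S := by
        intro m' S hmm'
        refine himage hE (hcs_mono hmm' (subset_univ S)) (fun j hj => hEp j (hmm'.trans hj))
          (fun t _ => hEx t) ?_
        rw [hEim]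
        exact hcs'_mono hmm' (subset_univ S)
      -- the swap `θ` of `x κ` and `p m` over `Fκ := cs (m+1) {t ≠ κ}`
      set Fκ := cs (m + 1) {t | t ≠ κ} with hFκ
      have hFκcl : cl Fκ = Fκ := hcs_cl _ _
      have hxκ : x κ ∉ cl (Fκ ∪ {p m}) := by
        rw [hFκ, hP.cl_cl_union, hgen_succ]
        exact notMem_cl_inr hP hpx _ (fun h => h rfl)
      have hpm : p m ∉ cl (Fκ ∪ {x κ}) := by
        rw [hFκ, hP.cl_cl_union, union_assoc, ← image_singleton (f := x), ← image_union]
        exact notMem_cl_inl hP hpx (by simp) _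
      have hu : IndepFamilyOver cl Fκ (fun t : Bool => if t then x κ else p m) :=
        indepFamilyOver_bool hxκ hpm
      have hu' : IndepFamilyOver cl Fκ (fun t : Bool => if t then p m else x κ) :=
        indepFamilyOver_bool hpm hxκ
      have hspan : cl (Fκ ∪ {x κ, p m}) = cs m univ := by
        rw [hFκ, hP.cl_cl_union, show p '' {j | m + 1 ≤ j} ∪ x '' {t | t ≠ κ} ∪ {x κ, p m} =
          (p '' {j | m + 1 ≤ j} ∪ x '' univ ∪ {p m}) by
            ext y; simp only [mem_union, mem_image, mem_setOf_eq, mem_insert_iff,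
              mem_singleton_iff, mem_univ, true_and]
            constructor
            · rintro ((h | ⟨t, -, rfl⟩) | rfl | rfl)
              · exact Or.inl (Or.inl h)
              · exact Or.inl (Or.inr ⟨t, rfl⟩)
              · exact Or.inl (Or.inr ⟨κ, rfl⟩)
              · exact Or.inr rfl
            · rintro ((h | ⟨t, rfl⟩) | rfl)
              · exact Or.inl (Or.inl h)
              · by_cases ht : t = κ
                · subst ht; exact Or.inr (Or.inl rfl)
                · exact Or.inl (Or.inr ⟨t, ht, rfl⟩)
              · exact Or.inr (Or.inr rfl),
          hgen_succ]
      obtain ⟨θ, hθ, hθfix, hθu, hθim⟩ := hW.exists_isQFEmbOn_extend_indepFamily (f := id)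
        (Or.inl ⟨hFκcl, by rw [image_id]; exact hFκcl⟩) (IsQFEmbOn.id Fκ) hu
        (by rw [image_id]; exact hu')
      rw [range_bool, hspan] at hθ
      rw [range_bool, hspan, image_id, range_bool, pair_comm, hspan] at hθim
      have hθx : θ (x κ) = p m := by simpa using hθu true
      have hθp : θ (p m) = x κ := by simpa using hθu false
      have hθfix' : ∀ z ∈ Fκ, θ z = z := fun z hz => hθfix hz
      -- `θ` on sub-simplices
      have hθ_cs_succ : ∀ S : Set (Fin l), κ ∈ S →
          θ '' cs (m + 1) S = cs m (S \ {κ}) := by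
        intro S hκS
        have hsub : cs (m + 1) S ⊆ cs m univ := hcs_mono (Nat.le_succ m) (subset_univ S)
        have hgen : θ '' (p '' {j | m + 1 ≤ j} ∪ x '' S) =
            p '' {j | m + 1 ≤ j} ∪ x '' (S \ {κ}) ∪ {p m} := by
          ext y
          simp only [mem_image, mem_union, mem_setOf_eq, mem_sdiff, mem_singleton_iff]
          constructor
          · rintro ⟨z, hz, rfl⟩
            rcases hz with ⟨j, hj, rfl⟩ | ⟨t, ht, rfl⟩
            · exact Or.inl (Or.inl ⟨j, hj, (hθfix' _ (hp_cs _ hj)).symm⟩)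
            · by_cases htκ : t = κ
              · subst htκ; exact Or.inr hθx
              · exact Or.inl (Or.inr ⟨t, ⟨ht, htκ⟩,
                  (hθfix' _ (hx_cs _ (show t ∈ {t | t ≠ κ} from htκ))).symm⟩)
          · rintro ((⟨j, hj, rfl⟩ | ⟨t, ⟨ht, htκ⟩, rfl⟩) | rfl)
            · exact ⟨p j, Or.inl ⟨j, hj, rfl⟩, hθfix' _ (hp_cs _ hj)⟩
            · exact ⟨x t, Or.inr ⟨t, ht, rfl⟩, hθfix' _ (hx_cs _ (show t ∈ {t | t ≠ κ} from htκ))⟩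
            · exact ⟨x κ, Or.inr ⟨κ, hκS, rfl⟩, hθx⟩
        have := hθ.image_cl_eq hW (X := p '' {j | m + 1 ≤ j} ∪ x '' S) hsub (by
          rw [hθim, hgen, hgen_succ]; exact hcs_mono le_rfl (subset_univ _))
        rw [hgen, hgen_succ] at this
        exact this
      have hθD : θ '' cs (m + 1) univ = cs m {t | t ≠ κ} := by
        have hset : (univ : Set (Fin l)) \ {κ} = {t | t ≠ κ} := by ext t; simp
        rw [hθ_cs_succ univ (mem_univ κ), hset]
      have hθF : ∀ i : Fin l, i ≠ κ → θ '' cs (m + 1) {t | t ≠ i} = cs m {t | t ≠ i ∧ t ≠ κ} := by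
        intro i hiκ
        have hset : ({t : Fin l | t ≠ i}) \ {κ} = {t | t ≠ i ∧ t ≠ κ} := by ext t; simp
        rw [hθ_cs_succ {t | t ≠ i} (fun h => hiκ h.symm), hset]
      -- inverses
      set θi := Function.invFunOn θ (cs m univ) with hθi
      have hθiθ : ∀ z ∈ cs m univ, θi (θ z) = z := fun z hz => hθ.injOn.leftInvOn_invFunOn hz
      have hθθi : ∀ y ∈ cs m univ, θ (θi y) = y := fun y hy =>
        hθ.injOn.leftInvOn_invFunOn.rightInvOn_image (hθim.symm ▸ hy)
      have hθi_emb : IsQFEmbOn L θi (cs m univ) := by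
        have := hθ.inverse hθiθ; rwa [hθim] at this
      have hθi_fix : ∀ z ∈ Fκ, θi z = z := fun z hz => by
        conv_lhs => rw [← hθfix' z hz]
        exact hθiθ z (hcs_mono (Nat.le_succ m) (subset_univ _) hz)
      set Ei := Function.invFunOn E (cs m univ) with hEi
      have hEiE : ∀ z ∈ cs m univ, Ei (E z) = z := fun z hz => hE.injOn.leftInvOn_invFunOn hz
      have hEEi : ∀ y ∈ cs' m univ, E (Ei y) = y := fun y hy =>
        hE.injOn.leftInvOn_invFunOn.rightInvOn_image (hEim.symm ▸ hy)
      have hEi_emb : IsQFEmbOn L Ei (cs' m univ) := by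
        have := hE.inverse hEiE; rwa [hEim] at this
      have hEi_mem : ∀ y ∈ cs' m univ, Ei y ∈ cs m univ := fun y hy => by
        obtain ⟨z, hz, rfl⟩ : y ∈ E '' cs m univ := hEim.symm ▸ hy
        rw [hEiE z hz]; exact hz
      -- images along the chain
      have hgκ_emb : IsQFEmbOn L (g κ) (cs m {t | t ≠ κ}) :=
        (hg.isQFEmbOn κ hκj).mono (hcs_mono hnm Subset.rfl)
      have hgp : ∀ j, n ≤ j → g κ (p j) = p j := fun j hj =>
        hg.fix_tail κ hκj _ (hP.subset_cl _ ⟨j, hj, rfl⟩)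
      have hgκ_im : ∀ S : Set (Fin l), S ⊆ {t | t ≠ κ} → g κ '' cs m S = cs' m S := by
        intro S hS
        refine himage (hg.isQFEmbOn κ hκj) (hcs_mono hnm hS) (fun j hj => hgp j (hnm.trans hj))
          (fun t ht => hg.apply_vertex κ hκj t (hS ht)) ?_
        rw [hg.image_eq κ hκj]
        exact hcs'_mono hnm hS
      have hEi_im : ∀ S : Set (Fin l), Ei '' cs' m S = cs m S := by
        intro S
        rw [← hEim' m S le_rfl]
        exact (hE.injOn.leftInvOn_invFunOn.mono (hcs_mono le_rfl (subset_univ S))).image_image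
      have hθi_im : θi '' cs m {t | t ≠ κ} = cs (m + 1) univ := by
        rw [← hθD]
        exact (hθ.injOn.leftInvOn_invFunOn.mono (hcs_mono (Nat.le_succ m) Subset.rfl)).image_image
      -- the new map
      let E' : M → M := fun z => E (θi (Ei (g κ (θ z))))
      have hE'emb : IsQFEmbOn L E' (cs (m + 1) univ) := by
        have h1 : IsQFEmbOn L θ (cs (m + 1) univ) := hθ.mono (hcs_mono (Nat.le_succ m) Subset.rfl)
        have h2 : IsQFEmbOn L (g κ ∘ θ) (cs (m + 1) univ) := h1.comp (by rw [hθD]; exact hgκ_emb)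
        have h3 : IsQFEmbOn L (Ei ∘ (g κ ∘ θ)) (cs (m + 1) univ) := h2.comp (by
          rw [image_comp, hθD, hgκ_im _ Subset.rfl]
          exact hEi_emb.mono (hcs'_mono le_rfl (subset_univ _)))
        have h4 : IsQFEmbOn L (θi ∘ (Ei ∘ (g κ ∘ θ))) (cs (m + 1) univ) := h3.comp (by
          rw [image_comp, image_comp, hθD, hgκ_im _ Subset.rfl, hEi_im]
          exact hθi_emb.mono (hcs_mono le_rfl (subset_univ _)))
        have h5 : IsQFEmbOn L (E ∘ (θi ∘ (Ei ∘ (g κ ∘ θ)))) (cs (m + 1) univ) := h4.comp (by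
          rw [image_comp, image_comp, image_comp, hθD, hgκ_im _ Subset.rfl, hEi_im, hθi_im]
          exact hE.mono (hcs_mono (Nat.le_succ m) Subset.rfl))
        exact h5
      have hE'im : E' '' cs (m + 1) univ = cs' (m + 1) univ := by
        change (E ∘ (θi ∘ (Ei ∘ (g κ ∘ θ)))) '' cs (m + 1) univ = _
        rw [image_comp, image_comp, image_comp, image_comp, hθD, hgκ_im _ Subset.rfl, hEi_im,
          hθi_im, hEim' (m + 1) univ (Nat.le_succ m)]
      -- agreement with `g κ` on the face `Fκ = cs (m+1) {t ≠ κ}`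
      have hE'κ : ∀ z ∈ Fκ, E' z = g κ z := by
        intro z hz
        change E (θi (Ei (g κ (θ z)))) = g κ z
        rw [hθfix' z hz]
        have hw : g κ z ∈ cl (p '' {j | m + 1 ≤ j} ∪ x' '' {t | t ≠ κ}) := by
          rw [← himage (hg.isQFEmbOn κ hκj) (hcs_mono (hnm.trans (Nat.le_succ m)) Subset.rfl)
            (fun j hj => hgp j ((hnm.trans (Nat.le_succ m)).trans hj))
            (fun t ht => hg.apply_vertex κ hκj t ht)
            (by rw [hg.image_eq κ hκj]; exact hcs'_mono (hnm.trans (Nat.le_succ m)) Subset.rfl)]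
          exact mem_image_of_mem _ hz
        obtain ⟨z', hz', hzw⟩ : g κ z ∈ E '' cs (m + 1) {t | t ≠ κ} := by
          rw [hEim' (m + 1) _ (Nat.le_succ m)]; exact hw
        rw [← hzw, hEiE z' (hcs_mono (Nat.le_succ m) (subset_univ _) hz'), hθi_fix z' hz']
      -- agreement with `g i`, `i ≤ k`, on the faces `cs (m+1) {t ≠ i}`
      have hE'i : ∀ i : Fin l, (i : ℕ) ≤ k → ∀ z ∈ cs (m + 1) {t | t ≠ i}, E' z = g i z := by
        intro i hi z hz
        have hiκ : i ≠ κ := fun h => by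
          have := congr_arg Fin.val h; simp [hκ] at this; omega
        change E (θi (Ei (g κ (θ z)))) = g i z
        have hθz : θ z ∈ cs m {t | t ≠ i ∧ t ≠ κ} := by
          rw [← hθF i hiκ]; exact mem_image_of_mem _ hz
        have hij : (i : ℕ) < jf := lt_of_le_of_lt hi (Nat.lt_of_succ_lt hk1)
        have h1 : g κ (θ z) = g i (θ z) :=
          (hg.compat i κ hij hκj _ (hcs_mono hnm Subset.rfl hθz)).symm
        have h2 : g i (θ z) = E (θ z) :=
          (hEg i hi _ (hcs_mono le_rfl (fun t ht => ht.1) hθz)).symm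
        have hθzD : θ z ∈ cs m univ := hcs_mono le_rfl (subset_univ _) hθz
        rw [h1, h2, hEiE _ hθzD, hθiθ z (hcs_mono (Nat.le_succ m) (subset_univ _) hz)]
        exact hEg i hi z (hcs_mono (Nat.le_succ m) Subset.rfl hz)
      refine ⟨E', ?_, fun i hi z hz => ?_, fun t => ?_, ?_⟩
      · exact hE'emb
      · rcases Nat.lt_succ_iff_lt_or_eq.1 (Nat.lt_succ_of_le hi) with hi' | hi'
        · exact hE'i i (Nat.lt_succ_iff.1 hi') z hz
        · have : i = κ := Fin.ext hi'
          subst this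
          exact hE'κ z hz
      · by_cases htκ : t = κ
        · subst htκ
          have h0 : ((⟨0, hl⟩ : Fin l) : ℕ) ≤ k := Nat.zero_le k
          have hne : (⟨k + 1, hk1l⟩ : Fin l) ≠ ⟨0, hl⟩ := fun h => by simp [Fin.ext_iff] at h
          rw [hE'i ⟨0, hl⟩ h0 _ (hx_cs (m + 1) hne), hg.apply_vertex _ h0j _ hne]
        · rw [hE'κ _ (hx_cs (m + 1) htκ), hg.apply_vertex κ hκj t htκ]
      · exact hE'im
  -- conclusion, at `k = jf - 1`
  obtain ⟨E, hE, hEg, hEx, hEim⟩ := main (jf - 1) (Nat.sub_lt hjf Nat.one_pos)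
  refine ⟨n + (jf - 1), Nat.le_add_right _ _, E, by rwa [hrange], fun i hi z hz => ?_,
    fun z hz => ?_, hEx, by rw [hrange, hrange']; exact hEim⟩
  · exact hEg i (Nat.le_sub_one_of_lt hi) z hz
  · have h0 : ((⟨0, hl⟩ : Fin l) : ℕ) ≤ jf - 1 := Nat.zero_le _
    rw [hEg ⟨0, hl⟩ h0 z (hT_cs _ _ hz)]
    exact hg.fix_tail _ hjf z (hP.mono (image_mono fun j (hj : _ ≤ j) =>
      (Nat.le_add_right n (jf - 1)).trans hj) hz)

end IsWeaklyQuasiminimalPregeometryStructure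

/-! ### The same over a fixed closed-off set `P` (tails `cl (P ∪ p[≥ n])`) -/

section Over

variable {p : ℕ → M} {l : ℕ} {x : Fin l → M} {P : Set M}

/-- `p m ∉ cl (P ∪ p[Q] ∪ x[S])` for `m ∉ Q`, for a family jointly independent over `P`.
[folklore] -/
theorem notMem_cl_inl_over (h : IsPregeometry cl) (hpx : IndepFamilyOver cl P (Sum.elim p x))
    {m : ℕ} {Q : Set ℕ} (hm : m ∉ Q) (S : Set (Fin l)) :
    p m ∉ cl (P ∪ (p '' Q ∪ x '' S)) := by
  intro hmem
  refine hpx (Sum.inl m) (h.mono (union_subset_union_right P ?_) hmem)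
  rintro _ (⟨j, hj, rfl⟩ | ⟨t, -, rfl⟩)
  · exact ⟨Sum.inl j, fun hji => hm (by cases hji; exact hj), rfl⟩
  · exact ⟨Sum.inr t, (fun h => by cases h), rfl⟩

/-- `x k ∉ cl (P ∪ p[Q] ∪ x[S])` for `k ∉ S`. [folklore] -/
theorem notMem_cl_inr_over (h : IsPregeometry cl) (hpx : IndepFamilyOver cl P (Sum.elim p x))
    (Q : Set ℕ) {k : Fin l} {S : Set (Fin l)} (hk : k ∉ S) :
    x k ∉ cl (P ∪ (p '' Q ∪ x '' S)) := by
  intro hmem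
  refine hpx (Sum.inr k) (h.mono (union_subset_union_right P ?_) hmem)
  rintro _ (⟨j, -, rfl⟩ | ⟨t, ht, rfl⟩)
  · exact ⟨Sum.inl j, (fun h => by cases h), rfl⟩
  · exact ⟨Sum.inr t, fun htk => hk (by cases htk; exact ht), rfl⟩

variable (L cl)

/-- Prescribed face maps with tails over a fixed set `P`: as `FacePrescription`, with every
`cl (p[≥ n] ∪ …)` replaced by `cl (P ∪ p[≥ n] ∪ …)`. [cite: Kirby2010QMEC, Thm 3.3 (proof)]
[cite: Haykazyan2016, Thm 16 (proof)] -/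
structure FacePrescriptionOver (P : Set M) (p : ℕ → M) {l : ℕ} (x x' : Fin l → M) (n jf : ℕ)
    (g : Fin l → M → M) : Prop where
  /-- `g i` is a partial embedding on the face (for the prescribed faces `i < jf`). -/
  isQFEmbOn : ∀ i : Fin l, (i : ℕ) < jf →
    IsQFEmbOn L (g i) (cl (P ∪ (p '' {j | n ≤ j} ∪ x '' {t | t ≠ i})))
  /-- … with image the corresponding face for `x'`. -/
  image_eq : ∀ i : Fin l, (i : ℕ) < jf → g i '' cl (P ∪ (p '' {j | n ≤ j} ∪ x '' {t | t ≠ i})) =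
    cl (P ∪ (p '' {j | n ≤ j} ∪ x' '' {t | t ≠ i}))
  /-- `g i` fixes the tail pointwise. -/
  fix_tail : ∀ i : Fin l, (i : ℕ) < jf → ∀ z ∈ cl (P ∪ p '' {j | n ≤ j}), g i z = z
  /-- `g i` sends the vertices `x_t`, `t ≠ i`, to `x'_t`. -/
  apply_vertex : ∀ i : Fin l, (i : ℕ) < jf → ∀ t, t ≠ i → g i (x t) = x' t
  /-- The `g i` agree on the pairwise intersections of the prescribed faces. -/
  compat : ∀ i i' : Fin l, (i : ℕ) < jf → (i' : ℕ) < jf →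
    ∀ z ∈ cl (P ∪ (p '' {j | n ≤ j} ∪ x '' {t | t ≠ i ∧ t ≠ i'})), g i z = g i' z

variable {L cl}

/-- **Extending compatible face maps across the crown, over a fixed set `P`**: the statement of
`exists_faceMaps_extension` with tails `cl (P ∪ p[≥ m])` for an arbitrary set `P` (the families
being jointly independent over `P`), so that the simplices `cl (P ∪ {x_t})` reached in the limit
keep the dimension of `cl P`. Same proof. [cite: Kirby2010QMEC, Thm 3.3 (proof)]
[cite: Haykazyan2016, Thm 16 (proof, Claim)] -/
theorem IsWeaklyQuasiminimalPregeometryStructure.exists_faceMaps_extension_over [Countable M]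
    (hW : IsWeaklyQuasiminimalPregeometryStructure L M cl) {x' : Fin l → M} {n jf : ℕ}
    {g : Fin l → M → M}
    (hpx : IndepFamilyOver cl P (Sum.elim p x)) (hpx' : IndepFamilyOver cl P (Sum.elim p x'))
    (hg : FacePrescriptionOver L cl P p x x' n jf g) (hjf : 0 < jf) (hjfl : jf ≤ l) :
    ∃ m, n ≤ m ∧ ∃ E : M → M, IsQFEmbOn L E (cl (P ∪ (p '' {j | m ≤ j} ∪ range x))) ∧
      (∀ i : Fin l, (i : ℕ) < jf →
        ∀ z ∈ cl (P ∪ (p '' {j | m ≤ j} ∪ x '' {t | t ≠ i})), E z = g i z) ∧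
      (∀ z ∈ cl (P ∪ p '' {j | m ≤ j}), E z = z) ∧ (∀ t, E (x t) = x' t) ∧
      E '' cl (P ∪ (p '' {j | m ≤ j} ∪ range x)) = cl (P ∪ (p '' {j | m ≤ j} ∪ range x')) := by
  classical
  have hP := hW.isPregeometry
  have hl : 0 < l := lt_of_lt_of_le hjf hjfl
  haveI : Nonempty M := ⟨p 0⟩
  -- notation
  set T : ℕ → Set M := fun m => cl (P ∪ p '' {j | m ≤ j}) with hT
  set cs : ℕ → Set (Fin l) → Set M := fun m S => cl (P ∪ (p '' {j | m ≤ j} ∪ x '' S)) with hcs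
  set cs' : ℕ → Set (Fin l) → Set M := fun m S => cl (P ∪ (p '' {j | m ≤ j} ∪ x' '' S)) with hcs'
  have hcs_cl : ∀ m S, cl (cs m S) = cs m S := fun m S => hP.cl_cl _
  have hcs'_cl : ∀ m S, cl (cs' m S) = cs' m S := fun m S => hP.cl_cl _
  have hcs_mono : ∀ {m m' : ℕ} {S S' : Set (Fin l)}, m ≤ m' → S' ⊆ S → cs m' S' ⊆ cs m S :=
    fun hmm' hSS' => hP.mono (union_subset_union_right P (union_subset_union
      (image_mono fun j (hj : _ ≤ j) => hmm'.trans hj) (image_mono hSS')))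
  have hcs'_mono : ∀ {m m' : ℕ} {S S' : Set (Fin l)}, m ≤ m' → S' ⊆ S → cs' m' S' ⊆ cs' m S :=
    fun hmm' hSS' => hP.mono (union_subset_union_right P (union_subset_union
      (image_mono fun j (hj : _ ≤ j) => hmm'.trans hj) (image_mono hSS')))
  have hT_cs : ∀ m S, T m ⊆ cs m S := fun m S =>
    hP.mono (union_subset_union_right P subset_union_left)
  have hP_cs : ∀ m S, P ⊆ cs m S := fun m S => (hP.subset_cl _).trans' subset_union_left
  have hp_cs : ∀ {m j} (S), m ≤ j → p j ∈ cs m S := fun S hmj =>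
    hP.subset_cl _ (Or.inr (Or.inl ⟨_, hmj, rfl⟩))
  have hx_cs : ∀ (m) {t S}, t ∈ S → x t ∈ cs m S := fun m t S ht =>
    hP.subset_cl _ (Or.inr (Or.inr ⟨t, ht, rfl⟩))
  have hrange : ∀ m, cl (P ∪ (p '' {j | m ≤ j} ∪ range x)) = cs m univ := fun m => by
    simp only [hcs, image_univ]
  have hrange' : ∀ m, cl (P ∪ (p '' {j | m ≤ j} ∪ range x')) = cs' m univ := fun m => by
    simp only [hcs', image_univ]
  -- generator identities
  have hgen_succ : ∀ (y : Fin l → M) m (S : Set (Fin l)),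
      P ∪ (p '' {j | m + 1 ≤ j} ∪ y '' S) ∪ {p m} = P ∪ (p '' {j | m ≤ j} ∪ y '' S) := by
    intro y m S
    ext z
    simp only [mem_union, mem_image, mem_setOf_eq, mem_singleton_iff]
    constructor
    · rintro ((h | ⟨j, hj, rfl⟩ | h) | rfl)
      · exact Or.inl h
      · exact Or.inr (Or.inl ⟨j, by omega, rfl⟩)
      · exact Or.inr (Or.inr h)
      · exact Or.inr (Or.inl ⟨m, le_rfl, rfl⟩)
    · rintro (h | ⟨j, hj, rfl⟩ | h)
      · exact Or.inl (Or.inl h)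
      · by_cases hjm : j = m
        · subst hjm; exact Or.inr rfl
        · exact Or.inl (Or.inr (Or.inl ⟨j, by omega, rfl⟩))
      · exact Or.inl (Or.inr (Or.inr h))
  have hgen_x : ∀ (y : Fin l → M) m (S : Set (Fin l)) (t : Fin l),
      P ∪ (p '' {j | m ≤ j} ∪ y '' S) ∪ {y t} = P ∪ (p '' {j | m ≤ j} ∪ y '' insert t S) := by
    intro y m S t
    ext z
    simp only [mem_union, mem_image, mem_setOf_eq, mem_singleton_iff, mem_insert_iff]
    constructor
    · rintro ((h | h | ⟨s, hs, rfl⟩) | rfl)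
      · exact Or.inl h
      · exact Or.inr (Or.inl h)
      · exact Or.inr (Or.inr ⟨s, Or.inr hs, rfl⟩)
      · exact Or.inr (Or.inr ⟨t, Or.inl rfl, rfl⟩)
    · rintro (h | h | ⟨s, rfl | hs, rfl⟩)
      · exact Or.inl (Or.inl h)
      · exact Or.inl (Or.inr (Or.inl h))
      · exact Or.inr rfl
      · exact Or.inl (Or.inr (Or.inr ⟨s, hs, rfl⟩))
  have hcs_p : ∀ m S, cl (cs (m + 1) S ∪ {p m}) = cs m S := fun m S => by
    simp only [hcs]; rw [hP.cl_cl_union, hgen_succ]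
  have hcs_x : ∀ m S t, cl (cs m S ∪ {x t}) = cs m (insert t S) := fun m S t => by
    simp only [hcs]; rw [hP.cl_cl_union, hgen_x]
  have hcs'_x : ∀ m S t, cl (cs' m S ∪ {x' t}) = cs' m (insert t S) := fun m S t => by
    simp only [hcs']; rw [hP.cl_cl_union, hgen_x]
  have hinsert_ne : ∀ i : Fin l, insert i {t : Fin l | t ≠ i} = univ := fun i => by
    ext t; by_cases h : t = i <;> simp [h]
  -- images of closures under maps fixing `P` and the tail and relabelling vertices
  have himage : ∀ {φ : M → M} {A : Set M} (_ : IsQFEmbOn L φ A) {m : ℕ} {S : Set (Fin l)}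
      {y : Fin l → M}, cs m S ⊆ A → (∀ z ∈ P, φ z = z) → (∀ j, m ≤ j → φ (p j) = p j) →
      (∀ t ∈ S, φ (x t) = y t) → cl (P ∪ (p '' {j | m ≤ j} ∪ y '' S)) ⊆ φ '' A →
      φ '' cs m S = cl (P ∪ (p '' {j | m ≤ j} ∪ y '' S)) := by
    intro φ A hφ m S y hA hPfix hp hxv him
    have hgen : φ '' (P ∪ (p '' {j | m ≤ j} ∪ x '' S)) = P ∪ (p '' {j | m ≤ j} ∪ y '' S) := by
      rw [image_union, image_union, ← image_comp, ← image_comp]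
      congr 1
      · exact (image_congr fun z hz => hPfix z hz).trans (image_id' P ▸ by simp)
      congr 1
      · exact image_congr fun j hj => hp j hj
      · exact image_congr fun t ht => hxv t ht
    rw [← hgen]
    refine hφ.image_cl_eq hW hA ?_
    rw [hgen]; exact him
  -- the inductive statement
  have main : ∀ k : ℕ, k < jf → ∃ E : M → M, IsQFEmbOn L E (cs (n + k) univ) ∧
      (∀ i : Fin l, (i : ℕ) ≤ k → ∀ z ∈ cs (n + k) {t | t ≠ i}, E z = g i z) ∧
      (∀ t, E (x t) = x' t) ∧ E '' cs (n + k) univ = cs' (n + k) univ := by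
    intro k
    induction k with
    | zero =>
      intro _
      set i₀ : Fin l := ⟨0, hl⟩ with hi₀
      have hi₀j : (i₀ : ℕ) < jf := hjf
      set G := cs n {t | t ≠ i₀} with hG
      have hGcl : cl G = G := hcs_cl _ _
      have hGim : g i₀ '' G = cs' n {t | t ≠ i₀} := hg.image_eq i₀ hi₀j
      have hx0 : x i₀ ∉ cl G := by
        rw [hGcl]; exact notMem_cl_inr_over hP hpx _ (fun h => h rfl)
      have hx0' : x' i₀ ∉ cl (g i₀ '' G) := by
        rw [hGim, hcs'_cl]; exact notMem_cl_inr_over hP hpx' _ (fun h => h rfl)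
      obtain ⟨E, hE, hEg, hEx, hEim⟩ := hW.exists_isQFEmbOn_extend_indepFamily
        (Or.inl ⟨hGcl, by rw [hGim]; exact hcs'_cl _ _⟩) (hg.isQFEmbOn i₀ hi₀j)
        (indepFamilyOver_unit hx0) (indepFamilyOver_unit hx0')
      have hdom : cl (G ∪ range fun _ : Unit => x i₀) = cs n univ := by
        rw [range_const, hG, hcs_x, hinsert_ne]
      have him : cl (g i₀ '' G ∪ range fun _ : Unit => x' i₀) = cs' n univ := by
        rw [range_const, hGim, hcs'_x, hinsert_ne]
      rw [hdom] at hE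
      rw [hdom, him] at hEim
      simp only [Nat.add_zero]
      refine ⟨E, hE, fun i hi z hz => ?_, fun t => ?_, hEim⟩
      · have : i = i₀ := Fin.ext (by simpa [hi₀] using hi)
        subst this
        exact hEg hz
      · by_cases ht : t = i₀
        · subst ht; exact hEx ()
        · rw [hEg (hx_cs n ht), hg.apply_vertex i₀ hi₀j t ht]
    | succ k ih =>
      intro hk1
      obtain ⟨E, hE, hEg, hEx, hEim⟩ := ih (Nat.lt_of_succ_lt hk1)
      set m := n + k with hm
      have hnm : n ≤ m := Nat.le_add_right n k
      have hk1l : k + 1 < l := lt_of_lt_of_le hk1 hjfl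
      set κ : Fin l := ⟨k + 1, hk1l⟩ with hκ
      have hκj : (κ : ℕ) < jf := hk1
      have h0j : ((⟨0, hl⟩ : Fin l) : ℕ) < jf := hjf
      -- facts about `E` at level `m`
      have hEfix : ∀ z ∈ T m, E z = z := fun z hz => by
        rw [hEg ⟨0, hl⟩ (Nat.zero_le k) z (hT_cs m _ hz)]
        exact hg.fix_tail _ h0j z (hP.mono (union_subset_union_right P
          (image_mono fun j (hj : m ≤ j) => hnm.trans hj)) hz)
      have hEP : ∀ z ∈ P, E z = z := fun z hz => hEfix z (hP.subset_cl _ (Or.inl hz))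
      have hEp : ∀ j, m ≤ j → E (p j) = p j := fun j hj =>
        hEfix _ (hP.subset_cl _ (Or.inr ⟨j, hj, rfl⟩))
      have hEim' : ∀ (m') (S : Set (Fin l)), m ≤ m' → E '' cs m' S = cs' m' S := by
        intro m' S hmm'
        refine himage hE (hcs_mono hmm' (subset_univ S)) hEP (fun j hj => hEp j (hmm'.trans hj))
          (fun t _ => hEx t) ?_
        rw [hEim]
        exact hcs'_mono hmm' (subset_univ S)
      -- the swap `θ` of `x κ` and `p m` over `Fκ := cs (m+1) {t ≠ κ}`
      set Fκ := cs (m + 1) {t | t ≠ κ} with hFκ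
      have hFκcl : cl Fκ = Fκ := hcs_cl _ _
      have hxκ : x κ ∉ cl (Fκ ∪ {p m}) := by
        rw [hFκ, hcs_p]
        exact notMem_cl_inr_over hP hpx _ (fun h => h rfl)
      have hpm : p m ∉ cl (Fκ ∪ {x κ}) := by
        rw [hFκ, hcs_x, hinsert_ne]
        simp only [hcs, image_univ]
        rw [← image_univ]
        exact notMem_cl_inl_over hP hpx (by simp) _
      have hu : IndepFamilyOver cl Fκ (fun t : Bool => if t then x κ else p m) :=
        indepFamilyOver_bool hxκ hpm
      have hu' : IndepFamilyOver cl Fκ (fun t : Bool => if t then p m else x κ) :=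
        indepFamilyOver_bool hpm hxκ
      have hspan : cl (Fκ ∪ {x κ, p m}) = cs m univ := by
        rw [insert_eq, ← union_assoc, union_comm Fκ {x κ}, ← hP.cl_cl_union, union_comm {x κ} Fκ,
          hFκ, hcs_x, hinsert_ne, hcs_p]
      obtain ⟨θ, hθ, hθfix, hθu, hθim⟩ := hW.exists_isQFEmbOn_extend_indepFamily (f := id)
        (Or.inl ⟨hFκcl, by rw [image_id]; exact hFκcl⟩) (IsQFEmbOn.id Fκ) hu
        (by rw [image_id]; exact hu')
      rw [range_bool, hspan] at hθ
      rw [range_bool, hspan, image_id, range_bool, pair_comm, hspan] at hθim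
      have hθx : θ (x κ) = p m := by simpa using hθu true
      have hθfix' : ∀ z ∈ Fκ, θ z = z := fun z hz => hθfix hz
      have hθP : ∀ z ∈ P, θ z = z := fun z hz => hθfix' z (hP_cs _ _ hz)
      -- `θ` on sub-simplices
      have hθ_cs_succ : ∀ S : Set (Fin l), κ ∈ S →
          θ '' cs (m + 1) S = cs m (S \ {κ}) := by
        intro S hκS
        have hsub : cs (m + 1) S ⊆ cs m univ := hcs_mono (Nat.le_succ m) (subset_univ S)
        have hgen : θ '' (P ∪ (p '' {j | m + 1 ≤ j} ∪ x '' S)) =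
            P ∪ (p '' {j | m + 1 ≤ j} ∪ x '' (S \ {κ})) ∪ {p m} := by
          ext y
          simp only [mem_image, mem_union, mem_setOf_eq, mem_sdiff, mem_singleton_iff]
          constructor
          · rintro ⟨z, hz, rfl⟩
            rcases hz with hz | ⟨j, hj, rfl⟩ | ⟨t, ht, rfl⟩
            · exact Or.inl (Or.inl (by rwa [hθP z hz]))
            · exact Or.inl (Or.inr (Or.inl ⟨j, hj, (hθfix' _ (hp_cs _ hj)).symm⟩))
            · by_cases htκ : t = κ
              · subst htκ; exact Or.inr hθx
              · exact Or.inl (Or.inr (Or.inr ⟨t, ⟨ht, htκ⟩,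
                  (hθfix' _ (hx_cs _ (show t ∈ {t | t ≠ κ} from htκ))).symm⟩))
          · rintro ((hy | ⟨j, hj, rfl⟩ | ⟨t, ⟨ht, htκ⟩, rfl⟩) | rfl)
            · exact ⟨y, Or.inl hy, hθP y hy⟩
            · exact ⟨p j, Or.inr (Or.inl ⟨j, hj, rfl⟩), hθfix' _ (hp_cs _ hj)⟩
            · exact ⟨x t, Or.inr (Or.inr ⟨t, ht, rfl⟩),
                hθfix' _ (hx_cs _ (show t ∈ {t | t ≠ κ} from htκ))⟩
            · exact ⟨x κ, Or.inr (Or.inr ⟨κ, hκS, rfl⟩), hθx⟩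
        have := hθ.image_cl_eq hW (X := P ∪ (p '' {j | m + 1 ≤ j} ∪ x '' S)) hsub (by
          rw [hθim, hgen, hgen_succ]; exact hcs_mono le_rfl (subset_univ _))
        rw [hgen, hgen_succ] at this
        exact this
      have hθD : θ '' cs (m + 1) univ = cs m {t | t ≠ κ} := by
        have hset : (univ : Set (Fin l)) \ {κ} = {t | t ≠ κ} := by ext t; simp
        rw [hθ_cs_succ univ (mem_univ κ), hset]
      have hθF : ∀ i : Fin l, i ≠ κ → θ '' cs (m + 1) {t | t ≠ i} = cs m {t | t ≠ i ∧ t ≠ κ} := by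
        intro i hiκ
        have hset : ({t : Fin l | t ≠ i}) \ {κ} = {t | t ≠ i ∧ t ≠ κ} := by ext t; simp
        rw [hθ_cs_succ {t | t ≠ i} (fun h => hiκ h.symm), hset]
      -- inverses
      set θi := Function.invFunOn θ (cs m univ) with hθi
      have hθiθ : ∀ z ∈ cs m univ, θi (θ z) = z := fun z hz => hθ.injOn.leftInvOn_invFunOn hz
      have hθi_emb : IsQFEmbOn L θi (cs m univ) := by
        have := hθ.inverse hθiθ; rwa [hθim] at this
      have hθi_fix : ∀ z ∈ Fκ, θi z = z := fun z hz => by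
        conv_lhs => rw [← hθfix' z hz]
        exact hθiθ z (hcs_mono (Nat.le_succ m) (subset_univ _) hz)
      set Ei := Function.invFunOn E (cs m univ) with hEi
      have hEiE : ∀ z ∈ cs m univ, Ei (E z) = z := fun z hz => hE.injOn.leftInvOn_invFunOn hz
      have hEi_emb : IsQFEmbOn L Ei (cs' m univ) := by
        have := hE.inverse hEiE; rwa [hEim] at this
      -- images along the chain
      have hgκ_emb : IsQFEmbOn L (g κ) (cs m {t | t ≠ κ}) :=
        (hg.isQFEmbOn κ hκj).mono (hcs_mono hnm Subset.rfl)
      have hgP : ∀ z ∈ P, g κ z = z := fun z hz =>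
        hg.fix_tail κ hκj _ (hP.subset_cl _ (Or.inl hz))
      have hgp : ∀ j, n ≤ j → g κ (p j) = p j := fun j hj =>
        hg.fix_tail κ hκj _ (hP.subset_cl _ (Or.inr ⟨j, hj, rfl⟩))
      have hgκ_im : ∀ S : Set (Fin l), S ⊆ {t | t ≠ κ} → g κ '' cs m S = cs' m S := by
        intro S hS
        refine himage (hg.isQFEmbOn κ hκj) (hcs_mono hnm hS) hgP
          (fun j hj => hgp j (hnm.trans hj)) (fun t ht => hg.apply_vertex κ hκj t (hS ht)) ?_
        rw [hg.image_eq κ hκj]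
        exact hcs'_mono hnm hS
      have hEi_im : ∀ S : Set (Fin l), Ei '' cs' m S = cs m S := by
        intro S
        rw [← hEim' m S le_rfl]
        exact (hE.injOn.leftInvOn_invFunOn.mono (hcs_mono le_rfl (subset_univ S))).image_image
      have hθi_im : θi '' cs m {t | t ≠ κ} = cs (m + 1) univ := by
        rw [← hθD]
        exact (hθ.injOn.leftInvOn_invFunOn.mono (hcs_mono (Nat.le_succ m) Subset.rfl)).image_image
      -- the new map
      let E' : M → M := fun z => E (θi (Ei (g κ (θ z))))
      have hE'emb : IsQFEmbOn L E' (cs (m + 1) univ) := by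
        have h1 : IsQFEmbOn L θ (cs (m + 1) univ) := hθ.mono (hcs_mono (Nat.le_succ m) Subset.rfl)
        have h2 : IsQFEmbOn L (g κ ∘ θ) (cs (m + 1) univ) := h1.comp (by rw [hθD]; exact hgκ_emb)
        have h3 : IsQFEmbOn L (Ei ∘ (g κ ∘ θ)) (cs (m + 1) univ) := h2.comp (by
          rw [image_comp, hθD, hgκ_im _ Subset.rfl]
          exact hEi_emb.mono (hcs'_mono le_rfl (subset_univ _)))
        have h4 : IsQFEmbOn L (θi ∘ (Ei ∘ (g κ ∘ θ))) (cs (m + 1) univ) := h3.comp (by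
          rw [image_comp, image_comp, hθD, hgκ_im _ Subset.rfl, hEi_im]
          exact hθi_emb.mono (hcs_mono le_rfl (subset_univ _)))
        exact h4.comp (by
          rw [image_comp, image_comp, image_comp, hθD, hgκ_im _ Subset.rfl, hEi_im, hθi_im]
          exact hE.mono (hcs_mono (Nat.le_succ m) Subset.rfl))
      have hE'im : E' '' cs (m + 1) univ = cs' (m + 1) univ := by
        change (E ∘ (θi ∘ (Ei ∘ (g κ ∘ θ)))) '' cs (m + 1) univ = _
        rw [image_comp, image_comp, image_comp, image_comp, hθD, hgκ_im _ Subset.rfl, hEi_im,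
          hθi_im, hEim' (m + 1) univ (Nat.le_succ m)]
      -- agreement with `g κ` on the face `Fκ`
      have hE'κ : ∀ z ∈ Fκ, E' z = g κ z := by
        intro z hz
        change E (θi (Ei (g κ (θ z)))) = g κ z
        rw [hθfix' z hz]
        have hw : g κ z ∈ cl (P ∪ (p '' {j | m + 1 ≤ j} ∪ x' '' {t | t ≠ κ})) := by
          rw [← himage (hg.isQFEmbOn κ hκj) (hcs_mono (hnm.trans (Nat.le_succ m)) Subset.rfl) hgP
            (fun j hj => hgp j ((hnm.trans (Nat.le_succ m)).trans hj))
            (fun t ht => hg.apply_vertex κ hκj t ht)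
            (by rw [hg.image_eq κ hκj]; exact hcs'_mono (hnm.trans (Nat.le_succ m)) Subset.rfl)]
          exact mem_image_of_mem _ hz
        obtain ⟨z', hz', hzw⟩ : g κ z ∈ E '' cs (m + 1) {t | t ≠ κ} := by
          rw [hEim' (m + 1) _ (Nat.le_succ m)]; exact hw
        rw [← hzw, hEiE z' (hcs_mono (Nat.le_succ m) (subset_univ _) hz'), hθi_fix z' hz']
      -- agreement with `g i`, `i ≤ k`, on the faces `cs (m+1) {t ≠ i}`
      have hE'i : ∀ i : Fin l, (i : ℕ) ≤ k → ∀ z ∈ cs (m + 1) {t | t ≠ i}, E' z = g i z := by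
        intro i hi z hz
        have hiκ : i ≠ κ := fun h => by
          have := congr_arg Fin.val h; simp [hκ] at this; omega
        change E (θi (Ei (g κ (θ z)))) = g i z
        have hθz : θ z ∈ cs m {t | t ≠ i ∧ t ≠ κ} := by
          rw [← hθF i hiκ]; exact mem_image_of_mem _ hz
        have hij : (i : ℕ) < jf := lt_of_le_of_lt hi (Nat.lt_of_succ_lt hk1)
        have h1 : g κ (θ z) = g i (θ z) :=
          (hg.compat i κ hij hκj _ (hcs_mono hnm Subset.rfl hθz)).symm
        have h2 : g i (θ z) = E (θ z) :=
          (hEg i hi _ (hcs_mono le_rfl (fun t ht => ht.1) hθz)).symm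
        have hθzD : θ z ∈ cs m univ := hcs_mono le_rfl (subset_univ _) hθz
        rw [h1, h2, hEiE _ hθzD, hθiθ z (hcs_mono (Nat.le_succ m) (subset_univ _) hz)]
        exact hEg i hi z (hcs_mono (Nat.le_succ m) Subset.rfl hz)
      refine ⟨E', ?_, fun i hi z hz => ?_, fun t => ?_, ?_⟩
      · exact hE'emb
      · rcases Nat.lt_succ_iff_lt_or_eq.1 (Nat.lt_succ_of_le hi) with hi' | hi'
        · exact hE'i i (Nat.lt_succ_iff.1 hi') z hz
        · have : i = κ := Fin.ext hi'
          subst this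
          exact hE'κ z hz
      · by_cases htκ : t = κ
        · subst htκ
          have h0 : ((⟨0, hl⟩ : Fin l) : ℕ) ≤ k := Nat.zero_le k
          have hne : (⟨k + 1, hk1l⟩ : Fin l) ≠ ⟨0, hl⟩ := fun h => by simp [Fin.ext_iff] at h
          rw [hE'i ⟨0, hl⟩ h0 _ (hx_cs (m + 1) hne), hg.apply_vertex _ h0j _ hne]
        · rw [hE'κ _ (hx_cs (m + 1) htκ), hg.apply_vertex κ hκj t htκ]
      · exact hE'im
  -- conclusion, at `k = jf - 1`
  obtain ⟨E, hE, hEg, hEx, hEim⟩ := main (jf - 1) (Nat.sub_lt hjf Nat.one_pos)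
  refine ⟨n + (jf - 1), Nat.le_add_right _ _, E, by rwa [hrange], fun i hi z hz => ?_,
    fun z hz => ?_, hEx, by rw [hrange, hrange']; exact hEim⟩
  · exact hEg i (Nat.le_sub_one_of_lt hi) z hz
  · have h0 : ((⟨0, hl⟩ : Fin l) : ℕ) ≤ jf - 1 := Nat.zero_le _
    rw [hEg ⟨0, hl⟩ h0 z (hT_cs _ _ hz)]
    exact hg.fix_tail _ hjf z (hP.mono (union_subset_union_right P
      (image_mono fun j (hj : _ ≤ j) => (Nat.le_add_right n (jf - 1)).trans hj)) hz)

end Over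

end Literature.ModelTheory.Quasiminimal

end
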